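import Summits.QuantumFields.YangMills.Theorems.UnitScaleTiltProp7StoreyHGradientRowOfWindowedHolder
import Summits.QuantumFields.YangMills.Theorems.UnitScaleTiltProp7GaugeProjectorRSSupMember
import Summits.QuantumFields.YangMills.Theorems.UnitScaleTiltProp7GreenOneGradientFamilyAllMembers
import HarnessLib

/-!
# Route `UnitScaleTilt`, crux K1 «MinimiserStabilityRegPr» (stmt-QuantumFields-19200), EX row (5) `norm_G`, STOREY H — **`h3`-FAMILY: THE 𝔊-DOOR's THIRD-WORD GRADIENT LETTER FOR ALL
# MEMBERS AS ONE `∃`-PACKAGE, MODULO px19's `hqG` AND ONE WINDOWED HÖLDER LETTER** (★★OWNER RULING №51 (d): «when `h3_family_exists` lands, the next S-edition swaps `h3row` for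
# `hHωw`»): H8-R′ v2 ✓`Prop7StoreyHGradientRowOfWindowedHolder.h3_of_windowedHolderLetter_allMembers` AT EVERY MEMBER of the printed J-slot `Δ₁ᴾ(T_Jᴾ)`, its value letters FED BY THEIR
# LANDED FAMILIES: (Div1) ⟸ O-G1 ✓`valueDiv_rows_GTone_of_letters` .2 over FILE C ✓`valueDiv_GT_DeltaEtaSlot_sup_family_allMembers` (+ `PosOnto` ✓`hco_DeltaEtaSlot_exists`∕✓`hco_DeltaOnePJ_exists_allMembers`,
# (c3), (tJ) ✓`tjValueRows_exists_allMembers`, (tJd) ✓`tjDivRows_family_of_h133_hqG_allMembers` ∘ ✓`h133_family_exists_allMembers` ⇒ `hqG` displayed, window ✓`hwinJ_of_cap`); `hR` ⟸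
# ✓∕⧗`Prop7GaugeProjectorRSSupMember.hR_sup_family`; (c1) ⟸ ✓`hc1_hc3_sup_family`; (c2) ⟸ ✓`hc2_sup_family_allMembers`; `hsmall` ⟸ an ε₀-cap; and ONE display: the WINDOWED cover-axial
# ½-Hölder modulus of `ω₁(A)` per member with an L-only constant `CHω L·‖A‖` (H8-R′ v2's `hHωw` binder at the member — pipeline (ii)'s deliverable, px19 g16).  OUTPUT = O5∕O5-R's displayed
# `h3row` binder TOKEN FOR TOKEN (RULING №51 (a)), no room.  (width seat `ym3-torus-px17` g13.)

Cell `ym3-torus` (HUMAN RULING D-0037; rung R3 = SU(2) YM₃ on T³ — NOT d = 4, NOT infinite volume, NOT a mass gap, NOT Clay).  THEOREMS ONLY (0 `def`, 0 `sorry`; ONE decl-local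
`maxHeartbeats 400000`, disclosed — measured: fails at 100k, passes at the default 200k once the cap is `clear_value`d); `--supports stmt-QuantumFields-19200 --as helper`; count-neutral.

WHAT IS PROVED (ns `Summit.QuantumFields.YangMills.Theorems.Prop7StoreyHGradientFamily`).  For positive L-only weights `c₀ cB : ℕ → ℝ`, a coupling window `0 < a₀ ≤ a₁`, px19's `hqG`
letter (T1's binder VERBATIM) and the windowed-Hölder family letter (`αw CHω hαw hCHω hHωwRow`):
* ★★★ `h3_family_exists` — `∃ αh M₃ : ℕ → ℝ` (cap with the three windows of record, `αh ≤ αq`, `αh ≤ αw`, `αh ≤ 1`, `0 ≤ M₃`) such that for every `L > 1`, `i : Idx L`, `U₀` with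
  `RegPr ρ U₀`, `ρ ≤ αh L`, under `Lift` (NO ROOM), every coupling in the window: O5's `h3row` body `∀ A, ‖nabla115 … (DL2 (GprimeP a (RS (DstarL2 (GT a (DeltaOneP a (TJSlotP a)) U₀ (toL2 A)))))) …‖ ≤ M₃ L * ‖A‖`.
HYP-SAT (★★OWNER RULING №42).  Displayed: `RegPr`∕cap∕`Lift`∕coupling window, `hqG` (as rows (5)(6)), `hHωwRow` = print's Thm 3.1 (3.42) ½-Hölder modulus class, WINDOWED, in a LOCAL
(cover-axial) gauge — no global gauge letter (RECORD 17df); a real inequality between displayed terms, `0 ≤ 0` at `A = 0`; constants EXISTENTIAL-but-L-only; conclusion non-vacuous; no `Prop`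
placeholder.  HONEST SCOPE.  An `∃`-assembly over landed packages; nothing of `hqG`, the Hölder letter, `norm_G`, EX, 19200 or the rung is proved; no summit is proved by a helper; the
Yang–Mills mass gap is NOT proved.

References: T. Bałaban, CMP **99** (1985) 389–434 [Balaban1985BackgroundPropagators] (Thm 3.1 (3.42)–(3.44) pp.397–398, p.399 L1–3, (3.117)–(3.138) pp.419–423, Thm 3.13 p.426);
CMP **102** (1985) 277–309 [Balaban1985Variational] (Thm 1 p.279, (19) p.281, (115)–(117) pp.294–295); CMP **96** (1984) 223–250 [Balaban1984PropagatorsII] ((1.40) p.230).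
-/

set_option autoImplicit false

noncomputable section

open scoped Matrix.Norms.L2Operator BigOperators InnerProductSpace ComplexConjugate

namespace Summit.QuantumFields.YangMills.Theorems.Prop7StoreyHGradientFamily

open Literature.MathematicalPhysics.QuantumFieldTheory.Balaban1983to89
open Literature.MathematicalPhysics.QuantumFieldTheory.Balaban1983to89.T3ContinuumYM3Torus
open Literature.MathematicalPhysics.QuantumFieldTheory.Balaban1983to89.T3Thm1Carrier (Idx)
open Literature.MathematicalPhysics.QuantumFieldTheory.Balaban1983to89.T3PrintedRegularMinimiser (RegPr)
open Literature.MathematicalPhysics.QuantumFieldTheory.Balaban1983to89.T3PrintedMinimiserExistence (regPr_mono)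
open B10Eq27TorusAxialLog (axialT)
open B4Sect5Torus (TSite tdist)
open B15DeterminingSets (embIter)
open T3SectALandauChart (bgUnits)
open B9SectCLatticeCarrier (Bond)
open B9Eq311L2Pairing (WL2)
open B11Eq111FrakG (nabla115)
open B11Eq103H1Complex (SiteL2K BondL2K)
open B5Eq118OneStroke (iterBlockOf)
open Summit.QuantumFields.YangMills.Theorems.Prop8Chart (emlIterU)
open Summit.QuantumFields.YangMills.Theorems.Prop7SectET3Transport (periodsT3 siteEquiv bondEquiv bgOfCfg)
open Summit.QuantumFields.YangMills.Theorems.Prop7SectET3HilbertLetters (W₂ toL2 toL2S toL2B DL2 DstarL2)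
open Summit.QuantumFields.YangMills.Theorems.Prop7SectET3GaugeProjector (RS)
open Summit.QuantumFields.YangMills.Theorems.Prop7SectET3WilsonHessian (DeltaEtaSlot)
open Summit.QuantumFields.YangMills.Theorems.Prop7SectET3CurvedPropagators (GT PosOnto)
open Summit.QuantumFields.YangMills.Theorems.Prop7SectET3DeltaPiPInv (GprimeP)
open Summit.QuantumFields.YangMills.Theorems.Prop7SectET3DeltaOne (avgHess)
open Summit.QuantumFields.YangMills.Theorems.Prop7SectET3DeltaOnePInv (DeltaOneP TJSlotP)
open Summit.QuantumFields.YangMills.Theorems.Prop7CurvedMemberLocalGradient (exists_curved_localGradient)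
open Summit.QuantumFields.YangMills.Theorems.Prop7CurvedMemberLocalHessian (exists_curved_localHessian)
open Summit.QuantumFields.YangMills.Theorems.AxialGaugeChartGlue (norm_bgOfCfg_axialT_sub_le)
open Summit.QuantumFields.YangMills.Theorems.Prop7OneFormCoerciveHolds (hco_DeltaEtaSlot_exists posOnto_of_coercive)
open Summit.QuantumFields.YangMills.Theorems.Prop7OneFormGreenSupRowsAllMembers (valueDiv_GT_DeltaEtaSlot_sup_family_allMembers)
open Summit.QuantumFields.YangMills.Theorems.Prop7ChainPotentialHessianFamily (alphaH_pos hc1_hc3_sup_family)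
open Summit.QuantumFields.YangMills.Theorems.Prop7GaugeProjectorC2SupAllMembers (hc2_sup_family_allMembers)
open Summit.QuantumFields.YangMills.Theorems.Prop7TJSlotCoerciveClosedAllMembers (tjValueRows_exists_allMembers hco_DeltaOnePJ_exists_allMembers)
open Summit.QuantumFields.YangMills.Theorems.Prop7H133FamilyPackageAllMembers (h133_family_exists_allMembers)
open Summit.QuantumFields.YangMills.Theorems.Prop7TJRowsFamilyOfH133AllMembers (tjDivRows_family_of_h133_hqG_allMembers)
open Summit.QuantumFields.YangMills.Theorems.Prop7GreenOneSupRowsOfLetters (valueDiv_rows_GTone_of_letters)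
open Summit.QuantumFields.YangMills.Theorems.Prop7GreenOneGradientFamily (hwinJ_of_cap)
open Summit.QuantumFields.YangMills.Theorems.Prop7GaugeProjectorRSSupMember (hR_sup_family)
open Summit.QuantumFields.YangMills.Theorems.Prop7StoreyHGradientRowOfWindowedHolder (h3_of_windowedHolderLetter_allMembers)
open Summit.QuantumFields.YangMills.Theorems.CoverSites

set_option maxHeartbeats 400000 in -- HEARTBEAT BUDGET (README owner rule 2026-08-28): ten-family knit, H8-R′'s ~3-kchar constant; measured fails 100k ∕ passes 200k (cap `clear_value`d); ×2 margin, decl-local.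
/-- ★★★ **THE `h3`-FAMILY — STOREY H's THIRD-WORD GRADIENT LETTER FOR ALL MEMBERS, NO ROOM, MODULO {`hqG`, THE WINDOWED HÖLDER FAMILY LETTER}** — H8-R′ v2 at every member with (Div1),
`hR`, (c1), (c2) fed by their landed families, `hsmall` by the cap; output = O5∕O5-R's `h3row` text.
[cite: Balaban1985BackgroundPropagators, Thm 3.1 (3.42)–(3.44) pp.397–398, (3.117)–(3.138) pp.419–423, Thm 3.13 p.426; Balaban1985Variational, Thm 1 p.279, (115)–(117) pp.294–295; Balaban1984PropagatorsII, (1.40) p.230] -/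
theorem h3_family_exists [hFL : ∀ F : T3Family, Fact (0 < (F.L : ℝ))] [hFη : ∀ (F : T3Family) (k : ℕ), Fact (0 < ((F.L : ℝ)⁻¹) ^ k)]
    (c₀ cB : ℕ → ℝ) [hc₀ : ∀ L : ℕ, Fact (0 < c₀ L)] [hcB : ∀ L : ℕ, Fact (0 < cB L)] {a₀ a₁ : ℝ} (ha₀ : 0 < a₀) (ha₀₁ : a₀ ≤ a₁)
    (αq qG : ℕ → ℝ) (hαq : ∀ L : ℕ, 1 < L → 0 < αq L) (hqG : ∀ L : ℕ, 1 < L → 0 ≤ qG L)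
    (hqGrow : ∀ (L : ℕ), 1 < L → ∀ (i : Idx L) (U₀ : GaugeField (i.1.1.P i.1.2.2) 0 (Matrix.specialUnitaryGroup (Fin 2) ℂ)), RegPr i.1.1 i.1.2.1 i.1.2.2 (αq L) U₀ →
      ∀ (X' : PBond (i.1.1.P i.1.2.2) 0 → Matrix (Fin 2) (Fin 2) ℂ) (s : ℝ) (x : Site (i.1.1.P i.1.2.2) 0) (A : Matrix (Fin 2) (Fin 2) ℂ), (∀ b, ‖X' b‖ ≤ s) →
        ∑ y : PBond (i.1.1.P i.1.2.1) 0, ‖avgHess i.1.1 i.1.2.1 i.1.2.2 i.2.2.le U₀ X'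
            ((toL2 i.1.1 i.1.2.2 (c₀ L)).symm (DL2 i.1.1 i.1.2.1 i.1.2.2 (c₀ L) U₀ (toL2S i.1.1 i.1.2.2 (c₀ L) (Pi.single x A)))) y‖
          ≤ qG L * ((L : ℝ) ^ (i.1.2.2 - i.1.2.1))⁻¹ * s * ‖A‖)
    (αw CHω : ℕ → ℝ) (hαw : ∀ L : ℕ, 1 < L → 0 < αw L) (hCHω : ∀ L : ℕ, 1 < L → 0 ≤ CHω L)
    (hHωwRow : ∀ (L : ℕ), 1 < L → ∀ (i : Idx L) (U₀ : GaugeField (i.1.1.P i.1.2.2) 0 (Matrix.specialUnitaryGroup (Fin 2) ℂ)), ∀ ρ : ℝ, RegPr i.1.1 i.1.2.1 i.1.2.2 ρ U₀ → ρ ≤ αw L →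
        (∀ cf : Site (i.1.1.P i.1.2.2) (i.1.2.2 - i.1.2.1) → Matrix (Fin 2) (Fin 2) ℂ,
        (∀ e' : PBond (i.1.1.P i.1.2.2) (i.1.2.2 - i.1.2.1), cf e'.src = ((emlIterU (i.1.2.2 - i.1.2.1) (bgUnits i.1.1 i.1.2.2 U₀) e' : (Matrix (Fin 2) (Fin 2) ℂ)ˣ) : Matrix (Fin 2) (Fin 2) ℂ) * cf e'.tgt *
        (((emlIterU (i.1.2.2 - i.1.2.1) (bgUnits i.1.1 i.1.2.2 U₀) e')⁻¹ : (Matrix (Fin 2) (Fin 2) ℂ)ˣ) : Matrix (Fin 2) (Fin 2) ℂ)) →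
        ∃ l₀ : Site (i.1.1.P i.1.2.2) 0 → Matrix (Fin 2) (Fin 2) ℂ,
        (∀ b' : PBond (i.1.1.P i.1.2.2) 0, l₀ b'.src = ((bgUnits i.1.1 i.1.2.2 U₀ b' : (Matrix (Fin 2) (Fin 2) ℂ)ˣ) : Matrix (Fin 2) (Fin 2) ℂ) * l₀ b'.tgt * (((bgUnits i.1.1 i.1.2.2 U₀ b')⁻¹ : (Matrix (Fin 2) (Fin 2) ℂ)ˣ) : Matrix (Fin 2) (Fin 2) ℂ)) ∧
        ∀ y : Site (i.1.1.P i.1.2.2) (i.1.2.2 - i.1.2.1), l₀ (embIter (i.1.2.2 - i.1.2.1) y) = cf y) →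
      ∀ a : ℝ, a₀ * (c₀ L / cB L) * ((i.1.1.L : ℝ) ^ (i.1.2.2 - i.1.2.1)) ^ 3 ≤ a → a ≤ a₁ * (c₀ L / cB L) * ((i.1.1.L : ℝ) ^ (i.1.2.2 - i.1.2.1)) ^ 3 →
      ∀ (A : PBond (i.1.1.P i.1.2.2) 0 → Matrix (Fin 2) (Fin 2) ℂ) (ct : Site ((i.1.1.cover 3).P i.1.2.2) 0) (yt yt' : TSite 3 (periodsT3 (i.1.1.cover 3) i.1.2.2)),
      tdist (periodsT3 (i.1.1.cover 3) i.1.2.2) (siteEquiv (i.1.1.cover 3) i.1.2.2 ct) yt ≤ 4 * (i.1.1.L : ℝ) ^ (i.1.2.2 - i.1.2.1) + 1 →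
      tdist (periodsT3 (i.1.1.cover 3) i.1.2.2) (siteEquiv (i.1.1.cover 3) i.1.2.2 ct) yt' ≤ 4 * (i.1.1.L : ℝ) ^ (i.1.2.2 - i.1.2.1) + 1 →
      tdist (periodsT3 (i.1.1.cover 3) i.1.2.2) yt yt' ≤ (i.1.1.L : ℝ) ^ (i.1.2.2 - i.1.2.1) →
      ‖WL2.equiv ℂ (fun _ : TSite 3 (periodsT3 (i.1.1.cover 3) i.1.2.2) => c₀ L) W₂
            (toL2S (i.1.1.cover 3) i.1.2.2 (c₀ L) (fun zt => ((axialT (U₀ ∘ projBond (i.1.1.P i.1.2.2) 3 0) ct zt : Matrix.specialUnitaryGroup (Fin 2) ℂ) : Matrix (Fin 2) (Fin 2) ℂ)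
              * (toL2S i.1.1 i.1.2.2 (c₀ L)).symm (RS i.1.1 i.1.2.1 i.1.2.2 i.2.2.le (c₀ L) (cB L) U₀ (DstarL2 i.1.1 i.1.2.1 i.1.2.2 (c₀ L) U₀ (GT i.1.1 i.1.2.1 i.1.2.2 i.2.2.le (c₀ L) (cB L) a (DeltaOneP i.1.1 i.1.2.1 i.1.2.2 i.2.2.le (c₀ L) (cB L) a (TJSlotP i.1.1 i.1.2.1 i.1.2.2 i.2.2.le (c₀ L) (cB L) a)) U₀ (toL2 i.1.1 i.1.2.2 (c₀ L) A)))) (proj (i.1.1.P i.1.2.2) 3 0 zt)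
              * star ((axialT (U₀ ∘ projBond (i.1.1.P i.1.2.2) 3 0) ct zt : Matrix.specialUnitaryGroup (Fin 2) ℂ) : Matrix (Fin 2) (Fin 2) ℂ))) yt'
          - WL2.equiv ℂ (fun _ : TSite 3 (periodsT3 (i.1.1.cover 3) i.1.2.2) => c₀ L) W₂
            (toL2S (i.1.1.cover 3) i.1.2.2 (c₀ L) (fun zt => ((axialT (U₀ ∘ projBond (i.1.1.P i.1.2.2) 3 0) ct zt : Matrix.specialUnitaryGroup (Fin 2) ℂ) : Matrix (Fin 2) (Fin 2) ℂ)
              * (toL2S i.1.1 i.1.2.2 (c₀ L)).symm (RS i.1.1 i.1.2.1 i.1.2.2 i.2.2.le (c₀ L) (cB L) U₀ (DstarL2 i.1.1 i.1.2.1 i.1.2.2 (c₀ L) U₀ (GT i.1.1 i.1.2.1 i.1.2.2 i.2.2.le (c₀ L) (cB L) a (DeltaOneP i.1.1 i.1.2.1 i.1.2.2 i.2.2.le (c₀ L) (cB L) a (TJSlotP i.1.1 i.1.2.1 i.1.2.2 i.2.2.le (c₀ L) (cB L) a)) U₀ (toL2 i.1.1 i.1.2.2 (c₀ L) A)))) (proj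 (i.1.1.P i.1.2.2) 3 0 zt)
              * star ((axialT (U₀ ∘ projBond (i.1.1.P i.1.2.2) 3 0) ct zt : Matrix.specialUnitaryGroup (Fin 2) ℂ) : Matrix (Fin 2) (Fin 2) ℂ))) yt‖
        ≤ (CHω L * ‖A‖) * (tdist (periodsT3 (i.1.1.cover 3) i.1.2.2) yt yt' / ((i.1.1.L : ℝ) ^ (i.1.2.2 - i.1.2.1))) ^ ((1 : ℝ) / 2))
 :
    ∃ (αh M₃ : ℕ → ℝ),
      (∀ L : ℕ, 1 < L → 0 < αh L) ∧ (∀ L : ℕ, 1 < L → 10 ^ 12 * (L : ℝ) ^ 3 * αh L ≤ 1) ∧ (∀ L : ℕ, 1 < L → 10 ^ 10 * (L : ℝ) ^ 6 * αh L ≤ 1) ∧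
      (∀ L : ℕ, 1 < L → 13 * 10 ^ 14 * (L : ℝ) ^ 3 * αh L ≤ 1) ∧ (∀ L : ℕ, 1 < L → αh L ≤ αq L) ∧ (∀ L : ℕ, 1 < L → αh L ≤ αw L) ∧ (∀ L : ℕ, 1 < L → αh L ≤ 1) ∧
      (∀ L : ℕ, 1 < L → 0 ≤ M₃ L) ∧
    ∀ (L : ℕ), 1 < L → ∀ (i : Idx L) (U₀ : GaugeField (i.1.1.P i.1.2.2) 0 (Matrix.specialUnitaryGroup (Fin 2) ℂ)), ∀ ρ : ℝ, RegPr i.1.1 i.1.2.1 i.1.2.2 ρ U₀ → ρ ≤ αh L →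
        (∀ cf : Site (i.1.1.P i.1.2.2) (i.1.2.2 - i.1.2.1) → Matrix (Fin 2) (Fin 2) ℂ,
        (∀ e' : PBond (i.1.1.P i.1.2.2) (i.1.2.2 - i.1.2.1), cf e'.src = ((emlIterU (i.1.2.2 - i.1.2.1) (bgUnits i.1.1 i.1.2.2 U₀) e' : (Matrix (Fin 2) (Fin 2) ℂ)ˣ) : Matrix (Fin 2) (Fin 2) ℂ) * cf e'.tgt *
        (((emlIterU (i.1.2.2 - i.1.2.1) (bgUnits i.1.1 i.1.2.2 U₀) e')⁻¹ : (Matrix (Fin 2) (Fin 2) ℂ)ˣ) : Matrix (Fin 2) (Fin 2) ℂ)) →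
        ∃ l₀ : Site (i.1.1.P i.1.2.2) 0 → Matrix (Fin 2) (Fin 2) ℂ,
        (∀ b' : PBond (i.1.1.P i.1.2.2) 0, l₀ b'.src = ((bgUnits i.1.1 i.1.2.2 U₀ b' : (Matrix (Fin 2) (Fin 2) ℂ)ˣ) : Matrix (Fin 2) (Fin 2) ℂ) * l₀ b'.tgt * (((bgUnits i.1.1 i.1.2.2 U₀ b')⁻¹ : (Matrix (Fin 2) (Fin 2) ℂ)ˣ) : Matrix (Fin 2) (Fin 2) ℂ)) ∧
        ∀ y : Site (i.1.1.P i.1.2.2) (i.1.2.2 - i.1.2.1), l₀ (embIter (i.1.2.2 - i.1.2.1) y) = cf y) →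
      ∀ a : ℝ, a₀ * (c₀ L / cB L) * ((i.1.1.L : ℝ) ^ (i.1.2.2 - i.1.2.1)) ^ 3 ≤ a → a ≤ a₁ * (c₀ L / cB L) * ((i.1.1.L : ℝ) ^ (i.1.2.2 - i.1.2.1)) ^ 3 →
      ∀ A : PBond (i.1.1.P i.1.2.2) 0 → Matrix (Fin 2) (Fin 2) ℂ,
      ‖nabla115 (((i.1.1.L : ℝ)⁻¹) ^ (i.1.2.2 - i.1.2.1)) (bgOfCfg i.1.1 i.1.2.2 U₀)
          (fun q : Bond 3 (periodsT3 i.1.1 i.1.2.2) => (toL2 i.1.1 i.1.2.2 (c₀ L)).symm (DL2 i.1.1 i.1.2.1 i.1.2.2 (c₀ L) U₀ (GprimeP i.1.1 i.1.2.1 i.1.2.2 i.2.2.le (c₀ L) (cB L) a U₀ (RS i.1.1 i.1.2.1 i.1.2.2 i.2.2.le (c₀ L) (cB L) U₀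
            (DstarL2 i.1.1 i.1.2.1 i.1.2.2 (c₀ L) U₀ (GT i.1.1 i.1.2.1 i.1.2.2 i.2.2.le (c₀ L) (cB L) a (DeltaOneP i.1.1 i.1.2.1 i.1.2.2 i.2.2.le (c₀ L) (cB L) a (TJSlotP i.1.1 i.1.2.1 i.1.2.2 i.2.2.le (c₀ L) (cB L) a)) U₀ (toL2 i.1.1 i.1.2.2 (c₀ L) A)))))) ((bondEquiv i.1.1 i.1.2.2).symm q))‖
        ≤ M₃ L * ‖A‖ := by
  classical
  -- the landed families
  obtain ⟨αco, γco, hαco, hWco, hwinco, hγco, hco⟩ := hco_DeltaEtaSlot_exists c₀ cB ha₀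
  obtain ⟨αcJ, γcJ, hαcJ, hWcJ, hwincJ, hγcJ, hcoJ⟩ := hco_DeltaOnePJ_exists_allMembers c₀ cB ha₀ ha₀₁
  obtain ⟨αS, BV, BD, hαS, hWS12, hWS10, hWS13, hBV, hBD, hS⟩ := valueDiv_GT_DeltaEtaSlot_sup_family_allMembers c₀ cB ha₀ ha₀₁
  obtain ⟨C₁, C₃, hC₁, hC₃, hc13⟩ := hc1_hc3_sup_family c₀ cB
  obtain ⟨C₂, hC₂, hc2⟩ := hc2_sup_family_allMembers c₀ cB
  obtain ⟨CR, hCR, hR⟩ := hR_sup_family c₀ cB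
  obtain ⟨αT, MT, hαT, hWT12, hWT10, hWT13, hWT16, hαT1, hMT, hT⟩ := tjValueRows_exists_allMembers c₀ cB ha₀ ha₀₁
  obtain ⟨αK, CH, δH, hαK, hWK12, hWK10, hWK13, hαK1, hCH, hδH, h133⟩ := h133_family_exists_allMembers c₀ cB ha₀ ha₀₁
  obtain ⟨αD, MD, hαD, hWD12, hWD10, hWD13, hαDK, hαDq, hαD1, hMD, hD⟩ :=
    tjDivRows_family_of_h133_hqG_allMembers c₀ cB αK CH δH hαK hWK12 hWK10 hWK13 hCH hδH h133 αq qG hαq hqG hqGrow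
  have hCH0 : 0 ≤ exists_curved_localHessian.choose := exists_curved_localHessian.choose_spec.1
  obtain ⟨hX0, -⟩ := norm_bgOfCfg_axialT_sub_le.choose_spec
  -- the window modulus and the cap
  set W : ℕ → ℝ := fun L => 4 * C₁ L * (BV L + BD L) + ((12 + MD L) * C₃ L * (1 + C₂ L + 4 * C₁ L * (BV L + BD L)) + MT L * (BV L + BD L)) * (1 + C₂ L) with hWd
  have hW0 : ∀ L : ℕ, 1 < L → 0 ≤ W L := fun L hL => by
    have := hC₁ L hL; have := hC₂ L hL; have := hC₃ L hL; have := hBV L hL; have := hBD L hL; have := hMT L hL; have := hMD L hL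
    simp only [hWd]; positivity
  set αh : ℕ → ℝ := fun L =>
    min (min (min (min (min (αco L) (αcJ L)) (min (αS L) (αT L))) (min (αD L)
      (min (1 / (10 ^ 12 * (L : ℝ) ^ 3)) (1 / (2 * ((exists_curved_localGradient.choose + 1) * (48 * (6 * Real.sqrt 2 * Real.sqrt 10 + 6 * Real.sqrt 2))))))))
    (min 1 (1 / (2 * W L + 1)))) (min (αw L) (1 / (2 * ((exists_curved_localHessian.choose + 1) * (48 * (6 * Real.sqrt 2 * Real.sqrt 10 + 6 * Real.sqrt 2)))))) with hαh
  have hαh0 : ∀ L : ℕ, 1 < L → 0 < αh L := fun L hL => by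
    have := hαco L hL; have := hαcJ L hL; have := hαS L hL; have := hαT L hL; have := hαD L hL
    have := alphaH_pos L hL; have := hW0 L hL; have := hαw L hL
    simp only [hαh]
    refine lt_min (lt_min (lt_min (lt_min (lt_min ‹_› ‹_›) (lt_min ‹_› ‹_›)) (lt_min ‹_› ‹_›)) (lt_min one_pos (by positivity))) (lt_min ‹_› (by positivity))
  have hαco' : ∀ L, αh L ≤ αco L := fun L => by
    simp only [hαh]; exact (min_le_left _ _).trans ((min_le_left _ _).trans ((min_le_left _ _).trans ((min_le_left _ _).trans (min_le_left _ _))))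
  have hαcJ' : ∀ L, αh L ≤ αcJ L := fun L => by
    simp only [hαh]; exact (min_le_left _ _).trans ((min_le_left _ _).trans ((min_le_left _ _).trans ((min_le_left _ _).trans (min_le_right _ _))))
  have hαS' : ∀ L, αh L ≤ αS L := fun L => by
    simp only [hαh]; exact (min_le_left _ _).trans ((min_le_left _ _).trans ((min_le_left _ _).trans ((min_le_right _ _).trans (min_le_left _ _))))
  have hαT' : ∀ L, αh L ≤ αT L := fun L => by
    simp only [hαh]; exact (min_le_left _ _).trans ((min_le_left _ _).trans ((min_le_left _ _).trans ((min_le_right _ _).trans (min_le_right _ _))))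
  have hαD' : ∀ L, αh L ≤ αD L := fun L => by
    simp only [hαh]; exact (min_le_left _ _).trans ((min_le_left _ _).trans ((min_le_right _ _).trans (min_le_left _ _)))
  have hαX' : ∀ L, αh L ≤ min (1 / (10 ^ 12 * (L : ℝ) ^ 3)) (1 / (2 * ((exists_curved_localGradient.choose + 1) * (48 * (6 * Real.sqrt 2 * Real.sqrt 10 + 6 * Real.sqrt 2))))) := fun L => by
    simp only [hαh]; exact (min_le_left _ _).trans ((min_le_left _ _).trans ((min_le_right _ _).trans (min_le_right _ _)))
  have hα1 : ∀ L, αh L ≤ 1 := fun L => by simp only [hαh]; exact (min_le_left _ _).trans ((min_le_right _ _).trans (min_le_left _ _))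
  have hαW : ∀ L, αh L ≤ 1 / (2 * W L + 1) := fun L => by simp only [hαh]; exact (min_le_left _ _).trans ((min_le_right _ _).trans (min_le_right _ _))
  have hαw' : ∀ L, αh L ≤ αw L := fun L => by simp only [hαh]; exact (min_le_right _ _).trans (min_le_left _ _)
  have hαHs : ∀ L, αh L ≤ 1 / (2 * ((exists_curved_localHessian.choose + 1) * (48 * (6 * Real.sqrt 2 * Real.sqrt 10 + 6 * Real.sqrt 2)))) := fun L => by
    simp only [hαh]; exact (min_le_right _ _).trans (min_le_right _ _)
  -- the cap is now used only through the inequalities above: make it opaque (its `min` carries `.choose` constants whose unfolding is what costs heartbeats)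
  clear_value αh
  clear hαh
  refine ⟨αh, fun L => (2 * (exists_curved_localHessian.choose *
            ((Real.sqrt 2 * (C₂ L * (2 * (BV L + BD L)))) + ((2 * Real.sqrt 2 * (4 * αh L * (3 + 2457 * norm_bgOfCfg_axialT_sub_le.choose)) * (CR L * (Real.sqrt 2 * (2 * (BV L + BD L)))) + (CHω L + 2 * (CR L * (Real.sqrt 2 * (2 * (BV L + BD L))))))
              + 2 * Real.sqrt 2 * ((4 * αh L * (3 + 2457 * norm_bgOfCfg_axialT_sub_le.choose)) * (Real.sqrt 2 * (C₂ L * (2 * (BV L + BD L)))) + (48 * αh L) * (3 * Real.sqrt 10 * (2 * Real.sqrt 2 * (48 * αh L) * (Real.sqrt 2 * (C₂ L * (2 * (BV L + BD L))))))))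
            + (6 * Real.sqrt 2 * (48 * αh L) * ((CR L * (Real.sqrt 2 * (2 * (BV L + BD L)))) + 2 * Real.sqrt 2 * (48 * αh L) * (Real.sqrt 2 * (C₂ L * (2 * (BV L + BD L)))) + 2 * Real.sqrt 2 * (48 * αh L) * (Real.sqrt 2 * (C₂ L * (2 * (BV L + BD L))))) + (Real.sqrt 2 * (C₂ L * (2 * (BV L + BD L))))
              + Real.sqrt 2 * ((2 * αh L + 24 * αh L ^ 2) * (Real.sqrt 2 * (C₁ L * (2 * (BV L + BD L)))) + 12 * αh L * (Real.sqrt 2 * (C₂ L * (2 * (BV L + BD L)))))))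
          + 2 * Real.sqrt 2 * (48 * αh L) * (Real.sqrt 2 * (C₂ L * (2 * (BV L + BD L)))))),
    hαh0, fun L hL => ?_, fun L hL => ?_, fun L hL => ?_, fun L hL => (hαD' L).trans (hαDq L hL), fun L _ => hαw' L, fun L _ => hα1 L, fun L hL => ?_, ?_⟩
  · exact (mul_le_mul_of_nonneg_left (hαco' L) (by positivity)).trans (hWco L hL)
  · exact (mul_le_mul_of_nonneg_left (hαS' L) (by positivity)).trans (hWS10 L hL)
  · exact (mul_le_mul_of_nonneg_left (hαco' L) (by positivity)).trans (hwinco L hL)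
  · have := hBV L hL; have := hBD L hL; have := hC₁ L hL; have := hC₂ L hL; have := hCR L hL; have := hCHω L hL; have := (hαh0 L hL).le
    positivity
  -- the member
  intro L hL i U₀ ρ hreg hρ hlift a ha₀a ha₁a
  have hc₀L : 0 < c₀ L := (hc₀ L).out
  have hcBL : 0 < cB L := (hcB L).out
  have hL0 : (0 : ℝ) < L := by exact_mod_cast lt_trans zero_lt_one hL
  have hLL : (L : ℝ) = (i.1.1.L : ℝ) := by rw [i.2.1]
  have hαL := hαh0 L hL
  have ha : 0 ≤ a := le_trans (by positivity) ha₀a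
  have hregh : RegPr i.1.1 i.1.2.1 i.1.2.2 (αh L) U₀ := regPr_mono i.1.1 hρ hreg
  -- the windows of record at this member
  have hw13 : 13 * 10 ^ 14 * (i.1.1.L : ℝ) ^ 3 * αh L ≤ 1 := by
    rw [← hLL]; exact (mul_le_mul_of_nonneg_left (hαco' L) (by positivity)).trans (hwinco L hL)
  -- PosOnto at the two slots
  have hp₀ : PosOnto i.1.1 i.1.2.1 i.1.2.2 i.2.2.le (c₀ L) (cB L) a (DeltaEtaSlot i.1.1 i.1.2.1 i.1.2.2 (c₀ L)) U₀ :=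
    posOnto_of_coercive i.2.2.le (cB L) i.2.2 hregh hw13 (hγco L hL) _ (hco L hL i U₀ ρ hreg (hρ.trans (hαco' L)) hlift a ha₀a)
  have hp₁ : PosOnto i.1.1 i.1.2.1 i.1.2.2 i.2.2.le (c₀ L) (cB L) a
      (DeltaOneP i.1.1 i.1.2.1 i.1.2.2 i.2.2.le (c₀ L) (cB L) a (TJSlotP i.1.1 i.1.2.1 i.1.2.2 i.2.2.le (c₀ L) (cB L) a)) U₀ :=
    (hcoJ L hL i U₀ ρ hreg (hρ.trans (hαcJ' L)) hlift a ha₀a ha₁a).2.1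
  -- the letters at this member
  obtain ⟨hV, hDiv⟩ := hS L hL i U₀ ρ hreg (hρ.trans (hαS' L)) hlift a ha₀a ha₁a
  have hc13m := hc13 L hL i U₀ ρ hreg (hρ.trans (hαX' L)) hlift a ha
  have hc1 := fun (w : Site (i.1.1.P i.1.2.2) 0 → Matrix (Fin 2) (Fin 2) ℂ) (m' : ℝ) (hw : ∀ x, ‖w x‖ ≤ m') => (hc13m w m' hw).1
  have hc3 := fun (w : Site (i.1.1.P i.1.2.2) 0 → Matrix (Fin 2) (Fin 2) ℂ) (m' : ℝ) (hw : ∀ x, ‖w x‖ ≤ m') => (hc13m w m' hw).2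
  have hc2m := hc2 L hL i U₀ ρ hreg (hρ.trans (hαX' L)) hlift a ha
  have hRm := hR L hL i U₀ ρ hreg (hρ.trans (hαX' L)) hlift
  have hHwm := hHωwRow L hL i U₀ ρ hreg (hρ.trans (hαw' L)) hlift a ha₀a ha₁a
  -- (tJ): the sup row of `T_Jᴾ` at `ρ' := αh L`
  have hTJ : ∀ (Y : PBond (i.1.1.P i.1.2.2) 0 → Matrix (Fin 2) (Fin 2) ℂ) (s' : ℝ), (∀ b, ‖Y b‖ ≤ s') →
      ∀ b, ‖(toL2 i.1.1 i.1.2.2 (c₀ L)).symm (TJSlotP i.1.1 i.1.2.1 i.1.2.2 i.2.2.le (c₀ L) (cB L) a U₀ (toL2 i.1.1 i.1.2.2 (c₀ L) Y)) b‖ ≤ (αh L * MT L) * s' :=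
    (hT L hL i U₀ ρ hreg (hρ.trans (hαT' L)) hlift a ha₀a ha₁a).1 (αh L) hαL.le (hαT' L) hregh
  -- (tJd): the divergence row of `T_Jᴾ` at `ρ' := αh L`, rate `δ := 0` (modulo `hqG`)
  have hTJd : ∀ (Y : PBond (i.1.1.P i.1.2.2) 0 → Matrix (Fin 2) (Fin 2) ℂ) (s' : ℝ), (∀ b, ‖Y b‖ ≤ s') →
      ∀ x, ‖(toL2S i.1.1 i.1.2.2 (c₀ L)).symm (DstarL2 i.1.1 i.1.2.1 i.1.2.2 (c₀ L) U₀
        (TJSlotP i.1.1 i.1.2.1 i.1.2.2 i.2.2.le (c₀ L) (cB L) a U₀ (toL2 i.1.1 i.1.2.2 (c₀ L) Y))) x‖ ≤ (αh L * MD L) * s' := by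
    intro Y s' hY x
    have hs' : 0 ≤ s' := (norm_nonneg _).trans (hY ⟨Classical.arbitrary _, 0⟩)
    have hrow := (hD L hL i U₀ ρ hreg (hρ.trans (hαD' L)) hlift a ha₀a ha₁a).1 (αh L) hαL (hαD' L) hregh 0 le_rfl
      (Classical.arbitrary _) Y s' hs' (fun b => by rw [zero_mul, neg_zero, Real.exp_zero, mul_one]; exact hY b) x
    simpa only [zero_mul, neg_zero, Real.exp_zero, mul_one] using hrow
  -- the `G₁` window
  have hwin : 4 * αh L * C₁ L * (BV L + BD L) + ((12 * αh L + αh L * MD L) * C₃ L * (1 + C₂ L + 4 * αh L * C₁ L * (BV L + BD L)) + (αh L * MT L) * (BV L + BD L)) * (1 + C₂ L)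
      ≤ 1 / 2 := by
    refine hwinJ_of_cap hαL.le (hα1 L) (hC₁ L hL) (hC₂ L hL) (hC₃ L hL) (add_nonneg (hBV L hL) (hBD L hL)) (hMT L hL) (hMD L hL) ?_
    have hWL := hW0 L hL
    have h1 := hαW L
    rw [le_div_iff₀ (by positivity)] at h1
    simpa only [hWd] using h1
  -- (Div1) at the J-slot, `(A, ‖A‖)` currency
  have hMTL := hMT L hL; have hMDL := hMD L hL; have hαhle := hαL.le
  have hCT0 : 0 ≤ αh L * MT L := mul_nonneg hαhle hMTL
  have hCTD0 : 0 ≤ αh L * MD L := mul_nonneg hαhle hMDL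
  have hD1 := fun (A : PBond (i.1.1.P i.1.2.2) 0 → Matrix (Fin 2) (Fin 2) ℂ) =>
    (valueDiv_rows_GTone_of_letters (TJSlotP i.1.1 i.1.2.1 i.1.2.2 i.2.2.le (c₀ L) (cB L) a) U₀ hregh ha hp₀ hp₁
      (hBV L hL) (hBD L hL) (hC₁ L hL) (hC₂ L hL) (hC₃ L hL) hCT0 hCTD0 hV hDiv hc1 hc2m hc3 hTJ hTJd hwin A (s := ‖A‖) (fun b => norm_le_pi_norm A b)).2
  -- H7-R's absorption margin from the cap (the `.choose` constant made opaque first — cheap arithmetic)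
  have hsmall : exists_curved_localHessian.choose * ((48 * αh L) * (6 * Real.sqrt 2 * Real.sqrt 10 + 6 * Real.sqrt 2)) ≤ 1 / 2 := by
    have h1 := hαHs L
    set Cc : ℝ := exists_curved_localHessian.choose with hCc
    clear_value Cc
    have hS0 : 0 < 6 * Real.sqrt 2 * Real.sqrt 10 + 6 * Real.sqrt 2 := by positivity
    have hX : 0 < (Cc + 1) * (48 * (6 * Real.sqrt 2 * Real.sqrt 10 + 6 * Real.sqrt 2)) := by positivity
    calc Cc * ((48 * αh L) * (6 * Real.sqrt 2 * Real.sqrt 10 + 6 * Real.sqrt 2))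
        ≤ (Cc + 1) * ((48 * αh L) * (6 * Real.sqrt 2 * Real.sqrt 10 + 6 * Real.sqrt 2)) :=
          mul_le_mul_of_nonneg_right (by linarith) (by positivity)
      _ = ((Cc + 1) * (48 * (6 * Real.sqrt 2 * Real.sqrt 10 + 6 * Real.sqrt 2))) * αh L := by ring
      _ ≤ ((Cc + 1) * (48 * (6 * Real.sqrt 2 * Real.sqrt 10 + 6 * Real.sqrt 2))) * (1 / (2 * ((Cc + 1) * (48 * (6 * Real.sqrt 2 * Real.sqrt 10 + 6 * Real.sqrt 2))))) :=
          mul_le_mul_of_nonneg_left h1 hX.le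
      _ = 1 / 2 := by field_simp
  -- H8-R′ v2 at the member
  have hB2 : 0 ≤ 2 * (BV L + BD L) := by have := hBV L hL; have := hBD L hL; positivity
  exact h3_of_windowedHolderLetter_allMembers i.1.1 i.2.2.le (c₀ L) (cB L)
    (DeltaOneP i.1.1 i.1.2.1 i.1.2.2 i.2.2.le (c₀ L) (cB L) a (TJSlotP i.1.1 i.1.2.1 i.1.2.2 i.2.2.le (c₀ L) (cB L) a)) hαL (hα1 L) U₀ hregh ha
    hB2 (hCR L hL) (hC₁ L hL) (hC₂ L hL) (hCHω L hL) hD1 hRm hc1 hc2m hHwm hsmall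

end Summit.QuantumFields.YangMills.Theorems.Prop7StoreyHGradientFamily

end
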